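import Mathlib
import HarnessLib
import Literature.MathematicalPhysics.QuantumLattice.HubbardUVSymbolCTDifferences
import Summits.HubbardSuperconductivity.HubbardSuperconductivity.Theorems.KLProgrammeC4aPPKernelModelWindowSum
import Summits.HubbardSuperconductivity.HubbardSuperconductivity.Theorems.KLProgrammeKLRegimeSplitEdgeFactsTransfer

/-!
# Route `KLProgramme` — crux C4a, S3 brick (B4) «(B4)-UMK1», «(B3)-K MODEL WINDOW» part 3: the ENGINE's / the MODEL's pp and ph bubbles at ZERO TRANSFER are
# (lattice-momentum sums of) the window kernel `P_M = P − R_M` — class-#5 pair sum/mass, plain slice weight, and the second-order tadpole vertex's `S_pp`, `S_ph`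

Cell `gate-hubbard-kl`, seat hubbard-kl-k3c3-p1 (g18; row «δμ-flow with klAngularMean constant piece»).  Companion of `…C4aPPKernelModelWindow` (part 1: `P = P_M + R_M`,
count-free tails) and `…ModelWindowSum` (part 2: `(1/β)Σᵢ Ψ̂_{ωᵢ}(e)Ψ̂_{−ωᵢ}(u) = P_M(e,u)`, `uvSymbolFn c` forms).  Objects: `propCT β μ K (ν,p) = 1/(−iω_ν + e_K(p))`
(`…TwoPointAssemblyLimitDefs`), `hubbardCutoffWeightCT β μ K Λ (ν,p) = χ((ω_ν² + e_K(p)²)/Λ²)`, `uvSymbolCT … Λ ((ν,p⃗),σ) = Ψ_{βL²}(e_K p⃗, ω_ν)` (Literature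
`uvSymbolCT_eq_uvSymbolFn`); p1 g11's `klBubbleSum β μ K a b Qm p = Σ_ν a(ν,p)b(ν.rev,Qm−p)ĝ_K(ν,p)ĝ_K(ν.rev,Qm−p)`, `klBubbleMass = (βL²)⁻¹·Re klBubbleSum`,
`klSliceWeightPlain … n = b[w_{Λ_n}] − b[w_{Λ_{n−1}}]` (`…SplitEdgeFactsTransfer`); c4a-1 g6's second-order vertex `tadpoleVertex_klEffectiveAction_latticeMomentum`
(`…C4aSecondOrderVertexModel`) with `S_pp = Σ_{p,p′}[n_p + n_{p′} = n_κ + n_{p₀} ∧ p⃗ + p⃗′ = k⃗ + q⃗]Ψ_n(p)Ψ_n(p′)`, `S_ph = Σ_{p,p′}[n_p + n_{p₀} = n_{p′} + n_κ ∧ p⃗ + q⃗ = p⃗′ + k⃗]ΨΨ′`.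
* §6 `propCT_eq_resolventFnXi`, `hubbardCutoffWeightCT_eq_uvWeightFn`, `weight_mul_propCT_eq_uvSymbolFnXi`; **`klBubbleSum_aboveWeights_eq`** (`= β·P_M(e_K p, e_K(Qm−p))`),
  `klBubbleMass_aboveWeights_eq` (`= P_M/L²`), **`klSliceWeightPlain_eq_ppWindowKernel_sub`** (`w_n = (P_M^{Λ_n} − P_M^{Λ_{n−1}})/L²`, `Λ_j = klScale klE0 j`),
  `klSliceWeightPlain_eq_true_sub_tail` (`= ((P^{Λ_n} − P^{Λ_{n−1}}) − (R_M^{Λ_n} − R_M^{Λ_{n−1}}))/L²`);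
* §7 `uvSymbolFn_neg_neg` (`Ψ_c(−u,−ω) = −Ψ_c(u,ω)`), **`matsubara_sum_uvSymbolFn_same_eq`** (ph pairing: `(1/β)Σᵢ Ψ_c(e,ωᵢ)Ψ_c(u,ωᵢ) = −c²·P_M(e,−u)`), the constrained-sum
  lemmas `sum_sum_ite_pp_zero_eq` / `sum_sum_ite_ph_zero_eq` (the conservation indicator picks the partner `(p.1.rev, S⃗ − p⃗)` resp. `(p.1, p⃗ + q⃗ − k⃗)`),
  **`secondOrder_ppBubble_zeroTransfer_eq`** (`n_κ + n_{p₀} = −1`: `S_pp = Σ_{p⃗} β(βL²)²·P_M(e_K p⃗, e_K(S⃗ − p⃗))`) and **`secondOrder_phBubble_zeroTransfer_eq`**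
  (`n_{p₀} = n_κ`: `S_ph = −Σ_{p⃗} β(βL²)²·P_M(e_K p⃗, −e_K(p⃗ + q⃗ − k⃗))` — the pp window kernel at the NEGATED partner level).
* §8 `loopCircle_layer_le_of_deriv_le_hybrid` / `loopCircle_layer_ppTailKernel_le_hybrid`: part 2's remainder law with a ϑ-DEPENDENT loop numerator `Y ϑ e v`
  (the «(U1)-HYBRID» slot shape of k3c3-p3 g36).
So at the zero-transfer slice frequencies both bubbles of stub (C)'s second-order vertex are lattice-momentum sums of the ONE kernel `P_M = P − R_M` whose (U1) rows and
count-free tails are landed; nonzero transfers `Ω = 2mπ/β` (windowed pairs `n + n′ = m_tot`) are the ℤ-series of `…C4aPPKernelShiftNumerator` minus window tails (on ask).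
Exact identities only; nothing asserts (C), any engine row, K3, the window or superconductivity.
References: BGM 2006 §2.1 (2.3)–(2.4), §2.3 [cite: BenfattoGiulianiMastropietro2006]; Salmhofer 1999 §2.4, §4.2.4 (4.63), §4.2.5 (4.70) [cite: Salmhofer1999].
-/

noncomputable section

namespace Summit.HubbardSuperconductivity.HubbardSuperconductivity.Theorems.C4a

set_option linter.dupNamespace false -- summit = problem name (single-conjunct summit), D-0017

open Real Finset Complex
open Literature.MathematicalPhysics.QuantumLattice Literature.Analysis.SpecialFunctions

/-! ## §6 ENGINE vocabulary: the pair sum / pair mass of the two above-scale weights IS `β·P_M` / `P_M/L²` -/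

section Engine

open Summit.HubbardSuperconductivity.HubbardSuperconductivity.Theorems.KLRegimeSplit
open Summit.HubbardSuperconductivity.HubbardSuperconductivity.Theorems.TwoPointAssembly
open Summit.HubbardSuperconductivity.HubbardSuperconductivity.Theorems.KLProgrammeLegKernels
open Literature.Probability.LatticeModels

variable {L M : ℕ}

/-- The frame propagator is the unit-volume band resolvent: `ĝ_K(ν,p) = resolventFnXi 1 0 ω_ν (e_K p)`. [cite: Salmhofer1999, §4.2.5 (4.70)] -/
theorem propCT_eq_resolventFnXi (β μ : ℝ) (K : TrigPolyC4v) (ν : MatsubaraIdx M) (p : TorusSite 2 L) :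
    propCT L M β μ K (ν, p) = resolventFnXi 1 0 (matsubaraFreq β M ν) (nambuXiCT L μ K p) := by
  simp only [propCT, resolventFnXi, add_zero]
  push_cast
  ring

/-- The above-scale weight of the frame is the level-variable weight: `w_Λ(ν,p) = W(ω_ν, e_K p)`. [cite: Salmhofer1999, §4.2.5 (4.70)] -/
theorem hubbardCutoffWeightCT_eq_uvWeightFn (β μ : ℝ) (K : TrigPolyC4v) (Λ : ℝ) (ν : MatsubaraIdx M) (p : TorusSite 2 L) :
    hubbardCutoffWeightCT L M β μ K Λ (ν, p) = uvWeightFn Λ (matsubaraFreq β M ν) (nambuXiCT L μ K p) := by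
  simp only [hubbardCutoffWeightCT, uvWeightFn, add_comm]

/-- One line of the pair sum: `w_Λ(ν,p)·ĝ_K(ν,p) = Ψ̂_{ω_ν}(e_K p)`. [cite: Salmhofer1999, §4.2.5 (4.70)] -/
theorem weight_mul_propCT_eq_uvSymbolFnXi (β μ : ℝ) (K : TrigPolyC4v) (Λ : ℝ) (ν : MatsubaraIdx M) (p : TorusSite 2 L) :
    ((hubbardCutoffWeightCT L M β μ K Λ (ν, p) : ℝ) : ℂ) * propCT L M β μ K (ν, p) = uvSymbolFnXi 1 Λ (matsubaraFreq β M ν) (nambuXiCT L μ K p) := by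
  rw [hubbardCutoffWeightCT_eq_uvWeightFn, propCT_eq_resolventFnXi, uvSymbolFnXi]

/-- **THE ENGINE'S PAIR SUM OF THE TWO ABOVE-SCALE WEIGHTS IS `β·P_M`**: `klBubbleSum β μ K w_Λ w_Λ Qm p = β·P_M(e_K p, e_K(Qm − p))` (`w_Λ = hubbardCutoffWeightCT … Λ`,
partner at `(ν.rev, Qm − p)`, `ω_{rev ν} = −ω_ν`). [cite: BenfattoGiulianiMastropietro2006, §2.1 (2.3)-(2.4)] -/
theorem klBubbleSum_aboveWeights_eq {β : ℝ} (hβ : 0 < β) (μ : ℝ) (K : TrigPolyC4v) (Λ : ℝ) (Qm p : TorusSite 2 L) :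
    klBubbleSum L M β μ K (hubbardCutoffWeightCT L M β μ K Λ) (hubbardCutoffWeightCT L M β μ K Λ) Qm p =
      ((β * ppWindowKernel β Λ M (nambuXiCT L μ K p) (nambuXiCT L μ K (Qm - p)) : ℝ) : ℂ) := by
  have h := matsubara_sum_pair_eq_ppWindowKernel hβ Λ M (nambuXiCT L μ K p) (nambuXiCT L μ K (Qm - p))
  have hterm : ∀ ν : MatsubaraIdx M,
      ((hubbardCutoffWeightCT L M β μ K Λ (ν, p) * hubbardCutoffWeightCT L M β μ K Λ (ν.rev, Qm - p) : ℝ) : ℂ) *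
          (propCT L M β μ K (ν, p) * propCT L M β μ K (ν.rev, Qm - p)) =
        uvSymbolFnXi 1 Λ (matsubaraFreq β M ν) (nambuXiCT L μ K p) * uvSymbolFnXi 1 Λ (-matsubaraFreq β M ν) (nambuXiCT L μ K (Qm - p)) := by
    intro ν
    rw [← weight_mul_propCT_eq_uvSymbolFnXi, ← matsubaraFreq_rev, ← weight_mul_propCT_eq_uvSymbolFnXi]
    push_cast
    ring
  unfold klBubbleSum
  rw [Finset.sum_congr rfl fun ν _ => hterm ν]
  have hβ0 : (β : ℂ) ≠ 0 := by exact_mod_cast hβ.ne'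
  have h' : ∑ i : MatsubaraIdx M, uvSymbolFnXi 1 Λ (matsubaraFreq β M i) (nambuXiCT L μ K p) * uvSymbolFnXi 1 Λ (-matsubaraFreq β M i) (nambuXiCT L μ K (Qm - p)) =
      (β : ℂ) * ((ppWindowKernel β Λ M (nambuXiCT L μ K p) (nambuXiCT L μ K (Qm - p)) : ℝ) : ℂ) := by
    rw [← h]; push_cast; field_simp
  rw [h']
  push_cast
  ring

/-- **THE ENGINE'S PAIR MASS OF THE TWO ABOVE-SCALE WEIGHTS IS `P_M/L²`**: `klBubbleMass β μ K w_Λ w_Λ Qm p = P_M(e_K p, e_K(Qm − p))/L²`.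
[cite: BenfattoGiulianiMastropietro2006, §2.1 (2.3)-(2.4)] -/
theorem klBubbleMass_aboveWeights_eq [NeZero L] {β : ℝ} (hβ : 0 < β) (μ : ℝ) (K : TrigPolyC4v) (Λ : ℝ) (Qm p : TorusSite 2 L) :
    klBubbleMass L M β μ K (hubbardCutoffWeightCT L M β μ K Λ) (hubbardCutoffWeightCT L M β μ K Λ) Qm p =
      ppWindowKernel β Λ M (nambuXiCT L μ K p) (nambuXiCT L μ K (Qm - p)) / (L : ℝ) ^ 2 := by
  unfold klBubbleMass
  rw [klBubbleSum_aboveWeights_eq hβ, Complex.ofReal_re]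
  have hL : (0 : ℝ) < (L : ℝ) := by exact_mod_cast Nat.pos_of_ne_zero (NeZero.ne L)
  field_simp

/-- **THE PLAIN SLICE WEIGHT OF STEP `n` IS THE TWO-SCALE WINDOW KERNEL `/L²`**: `w_n(Qm,p) = (P_M^{Λ_n} − P_M^{Λ_{n−1}})(e_K p, e_K(Qm − p))/L²`, `Λ_j = klScale klE0 j`.
[cite: BenfattoGiulianiMastropietro2006, §2.1 (2.3)-(2.4)] -/
theorem klSliceWeightPlain_eq_ppWindowKernel_sub [NeZero L] {β : ℝ} (hβ : 0 < β) (μ : ℝ) (K : TrigPolyC4v) (n : ℕ) (Qm p : TorusSite 2 L) :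
    klSliceWeightPlain L M β μ K n Qm p =
      (ppWindowKernel β (klScale klE0 n) M (nambuXiCT L μ K p) (nambuXiCT L μ K (Qm - p)) -
        ppWindowKernel β (klScale klE0 (n - 1)) M (nambuXiCT L μ K p) (nambuXiCT L μ K (Qm - p))) / (L : ℝ) ^ 2 := by
  unfold klSliceWeightPlain
  rw [klBubbleMass_aboveWeights_eq hβ, klBubbleMass_aboveWeights_eq hβ, sub_div]

/-- **… AND IN TERMS OF THE ALL-FREQUENCY KERNELS**: `w_n(Qm,p) = ((P^{Λ_n} − P^{Λ_{n−1}}) − (R_M^{Λ_n} − R_M^{Λ_{n−1}}))(e_K p, e_K(Qm − p))/L²` — the landed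
two-scale analysis (`…C4aPPKernelTwoScale`, `…TrueNumerator*`) applies to the engine's class-#5 slice weight up to the count-free tails of §3.
[cite: BenfattoGiulianiMastropietro2006, §2.1 (2.3)-(2.4)] -/
theorem klSliceWeightPlain_eq_true_sub_tail [NeZero L] {β : ℝ} (hβ : 0 < β) (μ : ℝ) (K : TrigPolyC4v) (n : ℕ) (Qm p : TorusSite 2 L) :
    klSliceWeightPlain L M β μ K n Qm p =
      ((ppTrueKernel β (klScale klE0 n) (nambuXiCT L μ K p) (nambuXiCT L μ K (Qm - p)) -
          ppTrueKernel β (klScale klE0 (n - 1)) (nambuXiCT L μ K p) (nambuXiCT L μ K (Qm - p))) -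
        (ppTailKernel β (klScale klE0 n) M (nambuXiCT L μ K p) (nambuXiCT L μ K (Qm - p)) -
          ppTailKernel β (klScale klE0 (n - 1)) M (nambuXiCT L μ K p) (nambuXiCT L μ K (Qm - p)))) / (L : ℝ) ^ 2 := by
  rw [klSliceWeightPlain_eq_ppWindowKernel_sub hβ, ppTrueKernel_eq_window_add_tail hβ (klScale klE0 n) M,
    ppTrueKernel_eq_window_add_tail hβ (klScale klE0 (n - 1)) M]
  ring

end Engine

/-! ## §7 The second-order vertex's pp / ph bubble sums at ZERO TRANSFER are lattice-momentum sums of `±β(βL²)²·P_M` -/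

section Vertex

open Literature.Probability.LatticeModels

variable {L M : ℕ} [NeZero L]

/-- `Ψ_c(−u, −ω) = −Ψ_c(u, ω)` (weight even in both variables, resolvent odd). [cite: Salmhofer1999, §4.2.5 (4.70)] -/
theorem uvSymbolFn_neg_neg (c Λ u ω : ℝ) : uvSymbolFn c Λ (-u) (-ω) = -uvSymbolFn c Λ u ω := by
  unfold uvSymbolFn resolventFn uvWeightFn
  have h : (-I * (((-ω) + 0 : ℝ) : ℂ) + ((-u : ℝ) : ℂ)) = -(-I * ((ω + 0 : ℝ) : ℂ) + (u : ℂ)) := by push_cast; ring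
  rw [h, div_neg, neg_sq, neg_sq, mul_neg]

/-- **Same-frequency pairing (the ph channel at zero transfer)**: `(1/β)·Σᵢ Ψ_c(e,ωᵢ)Ψ_c(u,ωᵢ) = −c²·P_M(e,−u)` — the ph pair kernel is MINUS the pp window kernel
at the NEGATED partner level (`Ψ_c(u,ωᵢ) = −Ψ_c(−u,ω_{rev i})`). [cite: BenfattoGiulianiMastropietro2006, §2.1 (2.3)-(2.4)] -/
theorem matsubara_sum_uvSymbolFn_same_eq {β : ℝ} (hβ : 0 < β) (c Λ : ℝ) (M : ℕ) (e u : ℝ) :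
    ((1 / β : ℝ) : ℂ) * ∑ i : MatsubaraIdx M, uvSymbolFn c Λ e (matsubaraFreq β M i) * uvSymbolFn c Λ u (matsubaraFreq β M i) =
      ((-(c ^ 2 * ppWindowKernel β Λ M e (-u)) : ℝ) : ℂ) := by
  have hneg : ∀ i : MatsubaraIdx M, uvSymbolFn c Λ u (matsubaraFreq β M i) = -uvSymbolFn c Λ (-u) (-matsubaraFreq β M i) := by
    intro i
    have := uvSymbolFn_neg_neg c Λ (-u) (-matsubaraFreq β M i)
    simp only [neg_neg] at this
    rw [this]
  simp_rw [hneg, mul_neg, Finset.sum_neg_distrib, mul_neg]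
  rw [matsubara_sum_uvSymbolFn_pair_eq hβ c Λ M e (-u)]
  push_cast
  ring

/-- **Constrained pair sum at zero pp transfer** (`n_p + n_{p′} = −1`, `p⃗ + p⃗′ = S⃗`): the partner of the line `p` is `(p.1.rev, S⃗ − p⃗)`. [folklore] -/
theorem sum_sum_ite_pp_zero_eq (f g : FreqMomentum L M → ℂ) (S : TorusSite 2 L) :
    ∑ p : FreqMomentum L M, ∑ p' : FreqMomentum L M,
        (if matsubaraInt M p.1 + matsubaraInt M p'.1 = -1 ∧ p.2 + p'.2 = S then f p * g p' else 0) =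
      ∑ p : FreqMomentum L M, f p * g (p.1.rev, S - p.2) := by
  refine Finset.sum_congr rfl fun p _ => ?_
  have hiff : ∀ p' : FreqMomentum L M, (matsubaraInt M p.1 + matsubaraInt M p'.1 = -1 ∧ p.2 + p'.2 = S) ↔ p' = (p.1.rev, S - p.2) := by
    intro p'
    constructor
    · rintro ⟨h1, h2⟩
      have h1' : matsubaraInt M p'.1 = matsubaraInt M p.1.rev := by rw [matsubaraInt_rev]; linarith
      have hfst : p'.1 = p.1.rev := by
        apply Fin.ext
        unfold matsubaraInt at h1'
        omega
      have hsnd : p'.2 = S - p.2 := by rw [← h2]; abel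
      exact Prod.ext hfst hsnd
    · rintro rfl
      refine ⟨?_, ?_⟩
      · rw [matsubaraInt_rev]; ring
      · show p.2 + (S - p.2) = S
        rw [add_comm, sub_add_cancel]
  simp_rw [hiff, Finset.sum_ite_eq', Finset.mem_univ, if_true]

/-- **Constrained pair sum at zero ph transfer** (`n_p + a = n_{p′} + a`, `p⃗ + q⃗ = p⃗′ + k⃗`): the partner of the line `p` is `(p.1, p⃗ + q⃗ − k⃗)`. [folklore] -/
theorem sum_sum_ite_ph_zero_eq (f g : FreqMomentum L M → ℂ) (a : ℤ) (k q : TorusSite 2 L) :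
    ∑ p : FreqMomentum L M, ∑ p' : FreqMomentum L M,
        (if matsubaraInt M p.1 + a = matsubaraInt M p'.1 + a ∧ p.2 + q = p'.2 + k then f p * g p' else 0) =
      ∑ p : FreqMomentum L M, f p * g (p.1, p.2 + q - k) := by
  refine Finset.sum_congr rfl fun p _ => ?_
  have hiff : ∀ p' : FreqMomentum L M, (matsubaraInt M p.1 + a = matsubaraInt M p'.1 + a ∧ p.2 + q = p'.2 + k) ↔ p' = (p.1, p.2 + q - k) := by
    intro p'
    constructor
    · rintro ⟨h1, h2⟩
      have hfst : p'.1 = p.1 := by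
        apply Fin.ext
        unfold matsubaraInt at h1
        omega
      have hsnd : p'.2 = p.2 + q - k := by rw [h2]; abel
      exact Prod.ext hfst hsnd
    · rintro rfl
      refine ⟨rfl, ?_⟩
      show p.2 + q = (p.2 + q - k) + k
      rw [sub_add_cancel]
  simp_rw [hiff, Finset.sum_ite_eq', Finset.mem_univ, if_true]

/-- The line sum over `FreqMomentum` splits as momentum × frequency. [folklore] -/
theorem sum_freqMomentum_eq_sum_sum (F : FreqMomentum L M → ℂ) :
    ∑ p : FreqMomentum L M, F p = ∑ pv : TorusSite 2 L, ∑ ν : MatsubaraIdx M, F (ν, pv) := by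
  rw [Fintype.sum_prod_type, Finset.sum_comm]

/-- **THE pp BUBBLE OF THE SECOND-ORDER TADPOLE VERTEX AT ZERO TRANSFER** (the `S_pp` term of `tadpoleVertex_klEffectiveAction_latticeMomentum` when
`n_κ + n_{p₀} = −1`, i.e. the slice frequency opposite to the external one): the constrained double sum of `Ψ_n(p)Ψ_n(p′)` is the lattice-momentum sum of
`β(βL²)²·P_M(e_K p⃗, e_K(S⃗ − p⃗))`, `S⃗ = k⃗ + q⃗`, `P_M` the window kernel of part 1 (`= P − R_M`). [cite: BenfattoGiulianiMastropietro2006, §2.1 (2.3)-(2.4)] -/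
theorem secondOrder_ppBubble_zeroTransfer_eq {β : ℝ} (hβ : 0 < β) (μ : ℝ) (K : TrigPolyC4v) (Λ : ℝ) {m : ℤ} (hm : m = -1) (S : TorusSite 2 L) :
    ∑ p : FreqMomentum L M, ∑ p' : FreqMomentum L M,
        (if matsubaraInt M p.1 + matsubaraInt M p'.1 = m ∧ p.2 + p'.2 = S then
          uvSymbolCT L M β μ K Λ (p, 0) * uvSymbolCT L M β μ K Λ (p', 0) else 0) =
      ∑ pv : TorusSite 2 L, ((β * (β * (L : ℝ) ^ 2) ^ 2 * ppWindowKernel β Λ M (nambuXiCT L μ K pv) (nambuXiCT L μ K (S - pv)) : ℝ) : ℂ) := by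
  subst hm
  rw [sum_sum_ite_pp_zero_eq (fun p => uvSymbolCT L M β μ K Λ (p, 0)) (fun p => uvSymbolCT L M β μ K Λ (p, 0)) S, sum_freqMomentum_eq_sum_sum]
  refine Finset.sum_congr rfl fun pv _ => ?_
  have h := matsubara_sum_uvSymbolFn_pair_rev_eq hβ (β * (L : ℝ) ^ 2) Λ M (nambuXiCT L μ K pv) (nambuXiCT L μ K (S - pv))
  simp_rw [uvSymbolCT_eq_uvSymbolFn hβ]
  have hβ0 : (β : ℂ) ≠ 0 := by exact_mod_cast hβ.ne'
  have h' : ∑ i : MatsubaraIdx M, uvSymbolFn (β * (L : ℝ) ^ 2) Λ (nambuXiCT L μ K pv) (matsubaraFreq β M i) *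
        uvSymbolFn (β * (L : ℝ) ^ 2) Λ (nambuXiCT L μ K (S - pv)) (matsubaraFreq β M i.rev) =
      (β : ℂ) * (((β * (L : ℝ) ^ 2) ^ 2 * ppWindowKernel β Λ M (nambuXiCT L μ K pv) (nambuXiCT L μ K (S - pv)) : ℝ) : ℂ) := by
    rw [← h]; push_cast; field_simp
  rw [h']
  push_cast
  ring

/-- **THE ph BUBBLE OF THE SECOND-ORDER TADPOLE VERTEX AT ZERO TRANSFER** (the `S_ph` term when the slice frequency equals the external one, `n_{p₀} = n_κ`): the
constrained double sum is the lattice-momentum sum of `−β(βL²)²·P_M(e_K p⃗, −e_K(p⃗ + q⃗ − k⃗))` — the pp window kernel at the NEGATED partner level (signed partner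
levels are covered by every landed row). [cite: BenfattoGiulianiMastropietro2006, §2.1 (2.3)-(2.4)] -/
theorem secondOrder_phBubble_zeroTransfer_eq {β : ℝ} (hβ : 0 < β) (μ : ℝ) (K : TrigPolyC4v) (Λ : ℝ) {a b : ℤ} (hab : a = b) (k q : TorusSite 2 L) :
    ∑ p : FreqMomentum L M, ∑ p' : FreqMomentum L M,
        (if matsubaraInt M p.1 + a = matsubaraInt M p'.1 + b ∧ p.2 + q = p'.2 + k then
          uvSymbolCT L M β μ K Λ (p, 0) * uvSymbolCT L M β μ K Λ (p', 0) else 0) =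
      ∑ pv : TorusSite 2 L, ((-(β * (β * (L : ℝ) ^ 2) ^ 2 * ppWindowKernel β Λ M (nambuXiCT L μ K pv) (-nambuXiCT L μ K (pv + q - k))) : ℝ) : ℂ) := by
  subst hab
  rw [sum_sum_ite_ph_zero_eq (fun p => uvSymbolCT L M β μ K Λ (p, 0)) (fun p => uvSymbolCT L M β μ K Λ (p, 0)) a k q, sum_freqMomentum_eq_sum_sum]
  refine Finset.sum_congr rfl fun pv _ => ?_
  have h := matsubara_sum_uvSymbolFn_same_eq hβ (β * (L : ℝ) ^ 2) Λ M (nambuXiCT L μ K pv) (nambuXiCT L μ K (pv + q - k))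
  simp_rw [uvSymbolCT_eq_uvSymbolFn hβ]
  have hβ0 : (β : ℂ) ≠ 0 := by exact_mod_cast hβ.ne'
  have h' : ∑ i : MatsubaraIdx M, uvSymbolFn (β * (L : ℝ) ^ 2) Λ (nambuXiCT L μ K pv) (matsubaraFreq β M i) *
        uvSymbolFn (β * (L : ℝ) ^ 2) Λ (nambuXiCT L μ K (pv + q - k)) (matsubaraFreq β M i) =
      (β : ℂ) * ((-((β * (L : ℝ) ^ 2) ^ 2 * ppWindowKernel β Λ M (nambuXiCT L μ K pv) (-nambuXiCT L μ K (pv + q - k))) : ℝ) : ℂ) := by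
    rw [← h]; push_cast; field_simp
  rw [h']
  push_cast
  ring

end Vertex

/-! ## §8 The remainder law with a ϑ-DEPENDENT loop numerator (the «(U1)-HYBRID» slot shape of k3c3-p3 g36) -/

section Hybrid

open MeasureTheory intervalIntegral Set

/-- **REMAINDER LAW, hybrid numerator**: as `loopCircle_layer_le_of_deriv_le` but with a loop numerator `Y ϑ e v` depending on the relative angle too (`|Y ϑ e v| ≤ Y₀` on
`|e| ≤ hi`): a kernel piece with `|∂ᵤKr(e,·)| ≤ ε` contributes `≤ ℓN·(2hi)·(2π)·(W·Y₀·ε)`. [cite: BenfattoGiulianiMastropietro2006, §2.4 (2.36)] -/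
theorem loopCircle_layer_le_of_deriv_le_hybrid {Kr : ℝ → ℝ → ℝ} {ε hi : ℝ} (hhi : 0 ≤ hi)
    (hK : ∀ e ∈ Icc (-hi) hi, ∀ u : ℝ, |deriv (fun v : ℝ => Kr e v) u| ≤ ε)
    {wt : ℝ → ℝ} {W : ℝ} (hw0 : ∀ e ∈ Icc (-hi) hi, 0 ≤ wt e) (hwW : ∀ e ∈ Icc (-hi) hi, wt e ≤ W)
    {Y : ℝ → ℝ → ℝ → ℝ} {Y₀ : ℝ} (hYb : ∀ ϑ, ∀ e ∈ Icc (-hi) hi, ∀ v, |Y ϑ e v| ≤ Y₀)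
    (g : ℝ → ℝ → ℝ → ℝ) (α₀ v₀ : ℝ) {ℓN : ℝ} (hℓ : 0 ≤ ℓN) :
    ∫ ϑ in α₀..(α₀ + ℓN), |∫ e in (-hi)..hi, ∫ v in v₀..(v₀ + 2 * π), wt e * (Y ϑ e v * deriv (fun v : ℝ => Kr e v) (g ϑ e v))| ≤
      ℓN * (2 * hi) * (2 * π) * (W * Y₀ * ε) := by
  have hW : 0 ≤ W := by
    have h0 : (0 : ℝ) ∈ Icc (-hi) hi := ⟨by linarith, hhi⟩
    exact (hw0 0 h0).trans (hwW 0 h0)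
  have hY₀ : 0 ≤ Y₀ := by
    have h0 : (0 : ℝ) ∈ Icc (-hi) hi := ⟨by linarith, hhi⟩
    exact (abs_nonneg _).trans (hYb 0 0 h0 0)
  have hmid : ∀ ϑ, |∫ e in (-hi)..hi, ∫ v in v₀..(v₀ + 2 * π), wt e * (Y ϑ e v * deriv (fun v : ℝ => Kr e v) (g ϑ e v))| ≤
      W * Y₀ * ε * (2 * π) * (2 * hi) := by
    intro ϑ
    have hb : ∀ e ∈ Set.uIoc (-hi) hi, ‖∫ v in v₀..(v₀ + 2 * π), wt e * (Y ϑ e v * deriv (fun v : ℝ => Kr e v) (g ϑ e v))‖ ≤ W * Y₀ * ε * (2 * π) := by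
      intro e he
      rw [Set.uIoc_of_le (by linarith : -hi ≤ hi)] at he
      have he' : e ∈ Icc (-hi) hi := ⟨he.1.le, he.2⟩
      have hb' : ∀ v ∈ Set.uIoc v₀ (v₀ + 2 * π), ‖wt e * (Y ϑ e v * deriv (fun v : ℝ => Kr e v) (g ϑ e v))‖ ≤ W * Y₀ * ε := by
        intro v _
        rw [Real.norm_eq_abs, abs_mul, abs_mul, abs_of_nonneg (hw0 e he')]
        calc wt e * (|Y ϑ e v| * |deriv (fun v : ℝ => Kr e v) (g ϑ e v)|) ≤ W * (Y₀ * ε) :=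
              mul_le_mul (hwW e he') (mul_le_mul (hYb ϑ e he' v) (hK e he' _) (abs_nonneg _) hY₀) (by positivity) hW
          _ = W * Y₀ * ε := by ring
      have h := intervalIntegral.norm_integral_le_of_norm_le_const hb'
      have hlen : |v₀ + 2 * π - v₀| = 2 * π := by rw [add_sub_cancel_left, abs_of_pos Real.two_pi_pos]
      rwa [hlen] at h
    have h := intervalIntegral.norm_integral_le_of_norm_le_const hb
    have hlen : |hi - -hi| = 2 * hi := by rw [sub_neg_eq_add, abs_of_nonneg (by linarith)]; ring
    rw [hlen, Real.norm_eq_abs] at h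
    exact h
  have hb : ∀ ϑ ∈ Set.uIoc α₀ (α₀ + ℓN), ‖|∫ e in (-hi)..hi, ∫ v in v₀..(v₀ + 2 * π), wt e * (Y ϑ e v * deriv (fun v : ℝ => Kr e v) (g ϑ e v))|‖ ≤
      W * Y₀ * ε * (2 * π) * (2 * hi) := fun ϑ _ => by rw [Real.norm_eq_abs, abs_abs]; exact hmid ϑ
  have h := intervalIntegral.norm_integral_le_of_norm_le_const hb
  have hlen : |α₀ + ℓN - α₀| = ℓN := by rw [add_sub_cancel_left, abs_of_nonneg hℓ]
  rw [hlen, Real.norm_eq_abs] at h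
  have hfin := (le_abs_self _).trans h
  calc _ ≤ W * Y₀ * ε * (2 * π) * (2 * hi) * ℓN := hfin
    _ = ℓN * (2 * hi) * (2 * π) * (W * Y₀ * ε) := by ring

/-- **THE REMAINDER LAW FOR `R_M/C`, hybrid numerator.** [cite: BenfattoGiulianiMastropietro2006, §2.4 (2.36)] -/
theorem loopCircle_layer_ppTailKernel_le_hybrid {β Λ : ℝ} (hβ : 0 < β) (hΛ : 0 < Λ) {B₁ : ℝ} (hB₁ : ∀ x, |deriv salmhoferCutoff x| ≤ B₁) (M : ℕ) {C : ℝ}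
    (hC : 0 < C) {hi : ℝ} (hhi : 0 ≤ hi) {wt : ℝ → ℝ} {W : ℝ} (hw0 : ∀ e ∈ Icc (-hi) hi, 0 ≤ wt e) (hwW : ∀ e ∈ Icc (-hi) hi, wt e ≤ W)
    {Y : ℝ → ℝ → ℝ → ℝ} {Y₀ : ℝ} (hYb : ∀ ϑ, ∀ e ∈ Icc (-hi) hi, ∀ v, |Y ϑ e v| ≤ Y₀) (g : ℝ → ℝ → ℝ → ℝ) (α₀ v₀ : ℝ) {ℓN : ℝ} (hℓ : 0 ≤ ℓN) :
    ∫ ϑ in α₀..(α₀ + ℓN), |∫ e in (-hi)..hi, ∫ v in v₀..(v₀ + 2 * π), wt e * (Y ϑ e v * deriv (fun v : ℝ => ppTailKernel β Λ M e v / C) (g ϑ e v))| ≤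
      ℓN * (2 * hi) * (2 * π) * (W * Y₀ * ((8 * B₁ / Λ + 5 / 2 * (β / π)) / ppFreq β M / C)) :=
  loopCircle_layer_le_of_deriv_le_hybrid (Kr := fun e v => ppTailKernel β Λ M e v / C) hhi
    (fun e _ u => abs_deriv_ppTailKernel_div_le hβ hΛ hB₁ M hC e u) hw0 hwW hYb g α₀ v₀ hℓ

end Hybrid

end Summit.HubbardSuperconductivity.HubbardSuperconductivity.Theorems.C4a

end
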